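import Mathlib
import Literature.Computability.AlgebraicComplexity.SimultaneousDoubleProduct
import Summits.MatrixMultiplication.MatrixMultiplication.Theses.FourierTwoFamiliesModP
import Summits.MatrixMultiplication.MatrixMultiplication.Theorems.FourierTwoFamiliesModPRemovalRegime

/-! F3 / BC5 WITNESS for the line `corner-gain` under crux `PrimeCyclicPowerGain` (stmt-MatrixMultiplication-14309).
The rung `CornerGain = ∀ K, ∃ c > 0, CornerSaving K (fun s => s ^ c)` SPECIALISES to the proved floor: for the
constant saving `f = fun _ => C` the graded family `CornerSaving K f` is the route's support item `RemovalRegime`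
(stmt-14314, PROVED: `Summit.MatrixMultiplication.MatrixMultiplication.Theorems.removalRegime_proof`, Green's
arithmetic removal lemma `k = 3`) at host `ZMod p`, `ε = 1/C`.  No sorry.  (Same text as `cornerSaving_const` in
`Lines/corner-gain.lean`; the graded family is copied verbatim so that this file elaborates on its own.) -/

set_option linter.dupNamespace false

namespace Summit.MatrixMultiplication.MatrixMultiplication.Cruxes.PrimeCyclicPowerGain.CornerGain.Special

open Summit.MatrixMultiplication.MatrixMultiplication.Theses.FourierTwoFamiliesModP

/-- graded family of the ladder (verbatim copy of `CornerGain.CornerSaving`). -/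
def CornerSaving (K : ℝ) (f : ℕ → ℝ) : Prop :=
  ∃ s₀ : ℕ, ∀ p : ℕ, p.Prime → ∀ (n s : ℕ) (A B : Fin n → Finset (ZMod p)), s₀ ≤ s →
    (n : ℝ) ≤ K * (s : ℝ) →
    (∀ i : Fin n, (A i).card = s ∧ (B i).card = s) →
    (∀ i : Fin n, ∀ a ∈ A i, ∀ a' ∈ A i, ∀ b ∈ B i, ∀ b' ∈ B i,
      (a - a') + (b - b') = 0 → a = a' ∧ b = b') →
    (∀ i j k : Fin n, ∀ a ∈ A i, ∀ a' ∈ A j, ∀ b ∈ B j, ∀ b' ∈ B k,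
      (a - a') + (b - b') = 0 → i = k) →
    (n : ℝ) * (s : ℝ) * f s ≤ (p : ℝ)

/-- **Witness: the rung at the floor parameter (constant saving) is the proved `RemovalRegime`.** -/
theorem cornerSaving_const (K C : ℝ) : CornerSaving K (fun _ => C) := by
  by_cases hC : C ≤ 0
  · refine ⟨0, ?_⟩
    intro p hp n s A B _ _ _ _ _
    have h1 : (n : ℝ) * (s : ℝ) * C ≤ 0 := mul_nonpos_of_nonneg_of_nonpos (by positivity) hC
    exact h1.trans (Nat.cast_nonneg p)
  · push Not at hC
    have hR := Summit.MatrixMultiplication.MatrixMultiplication.Theorems.removalRegime_proof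
    unfold RemovalRegime at hR
    obtain ⟨s₀, hs₀⟩ := hR K (1 / C) (by positivity)
    refine ⟨s₀, ?_⟩
    intro p hp n s A B hs hK hcard hW hX
    haveI : Fact p.Prime := ⟨hp⟩
    have h := hs₀ (ZMod p) n s A B hs hK hcard hW hX
    rw [ZMod.card] at h
    have h2 := mul_le_mul_of_nonneg_right h hC.le
    calc (n : ℝ) * (s : ℝ) * C ≤ 1 / C * (p : ℝ) * C := h2
      _ = (p : ℝ) := by field_simp

/-- F3 in the brief's literal shape: `example : Rung <floor parameters>`. -/
example (K C : ℝ) : CornerSaving K (fun _ => C) := cornerSaving_const K C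

/-- The floor at `K = 1` in the crux's own inequality shape: for every `ε > 0`, square-ish configurations
(`n ≤ s`) have `n · s ≤ ε · p` for `s` large. -/
example (ε : ℝ) (hε : 0 < ε) : ∃ s₀ : ℕ, ∀ p : ℕ, p.Prime → ∀ (n s : ℕ) (A B : Fin n → Finset (ZMod p)),
    s₀ ≤ s → (n : ℝ) ≤ 1 * (s : ℝ) →
    (∀ i : Fin n, (A i).card = s ∧ (B i).card = s) →
    (∀ i : Fin n, ∀ a ∈ A i, ∀ a' ∈ A i, ∀ b ∈ B i, ∀ b' ∈ B i,
      (a - a') + (b - b') = 0 → a = a' ∧ b = b') →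
    (∀ i j k : Fin n, ∀ a ∈ A i, ∀ a' ∈ A j, ∀ b ∈ B j, ∀ b' ∈ B k,
      (a - a') + (b - b') = 0 → i = k) →
    (n : ℝ) * (s : ℝ) ≤ ε * (p : ℝ) := by
  obtain ⟨s₀, hs₀⟩ := cornerSaving_const 1 (1 / ε)
  refine ⟨s₀, fun p hp n s A B hs hK hcard hW hX => ?_⟩
  have h : (n : ℝ) * (s : ℝ) * (1 / ε) ≤ (p : ℝ) := hs₀ p hp n s A B hs hK hcard hW hX
  rw [mul_one_div, div_le_iff₀ hε] at h
  linarith [mul_comm ε (p : ℝ)]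

end Summit.MatrixMultiplication.MatrixMultiplication.Cruxes.PrimeCyclicPowerGain.CornerGain.Special
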